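import Mathlib
import HarnessLib
import Summits.HubbardSuperconductivity.HubbardSuperconductivity.Theorems.KLProgrammePerturbedFermiCurveGaussMapTorus

/-!
# Route `KLProgramme` — ENGINE child (stmt-HubbardSuperconductivity-20437 `KLRegimeEngineV17F2`): the normal DIRECTION of the frame's Fermi curve mod π —
# «nearly parallel normals ⇒ equal or ANTIPODAL angles», quantitatively (the alternative behind the Cooper / caustic dichotomy of the two-shell bound;
# brick (T1)-input of the `TwoShellFrameAreaAt` witness, design note HOME/hubbard-kl-k3c2-p2/TWO-SHELL-FRAME-PORT.md §3)

Cell `gate-hubbard-kl`, seat hubbard-kl-k3c2-p2 g15; companion of `…GaussMapTorus` (p605734).  For an EVEN frame (`TrigPolyC4v.eval_neg`) the root selection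
is `π`-periodic and `α(θ + π) = α(θ) + π` (p4's `normalAngleFn_add_pi`): antipodal points carry opposite normals.  Hence the mod-π injectivity modulus:
* `abs_sub_sub_int_mul_pi_ge_of_expand` — GENERIC: `f(x + π) = f(x) + π` and `c·(y − x) ≤ f y − f x` (`x ≤ y`, `0 ≤ c`) ⇒ for every `k : ℤ`,
  `c·min(‖x − y‖_𝕋, ‖x − y − π‖_𝕋) ≤ |f x − f y − kπ|` (even `k`: the 2π case `torusDist_sub_ge_of_expand`; odd `k`: the same at `y + π`);
* **`normalAngleFn_halfTorus_ge_of_hessFloor`** / **`…_of_geomConstants`** — for a `π`-periodic root selection of the perturbed / frame curve: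
  `(u_min·w/(4+κ₁))·min(‖θ − θ′‖_𝕋, ‖θ − θ′ − π‖_𝕋) ≤ |α(θ) − α(θ′) − kπ|` for all `k : ℤ`;
* `normalAngle_perturbed_halfTorus_ge_of_geomConstants` — chart form for `u := perturbedFermiRadius δ_K ν` (`π`-periodic by `perturbedFermiRadius_add_pi` and
  `TrigPolyC4v.eval_neg`).
Everything is PROVED; no definitions, no named facts; nothing asserts any stub or superconductivity.
References: BGM 2003 §7.1 Lemma 7.1 (A1.9) [cite: BenfattoGiulianiMastropietro2003]; FST II §2.2, App. B [cite: FeldmanSalmhoferTrubowitz1998].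
-/

noncomputable section

namespace Summit.HubbardSuperconductivity.HubbardSuperconductivity.Theorems.PerturbedFermiCurve

set_option linter.dupNamespace false -- summit = problem name (single-conjunct summit), D-0017

open Real Set
open Literature.MathematicalPhysics.QuantumLattice Literature.MathematicalPhysics.QuantumLattice.BandSectorCounting
open Literature.MathematicalPhysics.QuantumLattice.FermiRG
open Summit.HubbardSuperconductivity.HubbardSuperconductivity.Theorems.DispersionFlow
open Summit.HubbardSuperconductivity.HubbardSuperconductivity.Theorems.KLRegimeSplit

/-! ## §1 Generic: expansion mod π from expansion on the line and the half-turn law -/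

/-- The half-turn law iterates to every integer multiple: `f(x + kπ) = f(x) + kπ`. [folklore] -/
theorem add_int_mul_pi_of_add_pi {f : ℝ → ℝ} (hper : ∀ x : ℝ, f (x + π) = f x + π) (x : ℝ) (k : ℤ) :
    f (x + k * π) = f x + k * π := by
  have hg : Function.Periodic (fun x => f x - x) π := fun x => by
    show f (x + π) - (x + π) = f x - x
    rw [hper]; ring
  have h : f (x + k * π) - (x + k * π) = f x - x := hg.int_mul k x
  linarith

/-- **Expansion mod π**: if `f(x + π) = f(x) + π` and `c·(y − x) ≤ f y − f x` for `x ≤ y` (`0 ≤ c`), then for every `k : ℤ`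
`c·min(‖x − y‖_𝕋, ‖x − y − π‖_𝕋) ≤ |f x − f y − kπ|` — two points whose images agree mod π are equal or antipodal mod 2π, quantitatively. [folklore] -/
theorem abs_sub_sub_int_mul_pi_ge_of_expand {f : ℝ → ℝ} {c : ℝ} (hc : 0 ≤ c) (hper : ∀ x : ℝ, f (x + π) = f x + π)
    (hexp : ∀ x y : ℝ, x ≤ y → c * (y - x) ≤ f y - f x) (x y : ℝ) (k : ℤ) :
    c * min (torusDist (x - y)) (torusDist (x - y - π)) ≤ |f x - f y - k * π| := by
  have hper2 : ∀ (z : ℝ) (m : ℤ), f (z + m * (2 * π)) = f z + m * (2 * π) := by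
    intro z m
    have h := add_int_mul_pi_of_add_pi hper z (2 * m)
    have e : ((2 * m : ℤ) : ℝ) * π = m * (2 * π) := by push_cast; ring
    rwa [e] at h
  have hmin0 : 0 ≤ min (torusDist (x - y)) (torusDist (x - y - π)) := le_min (norm_nonneg _) (norm_nonneg _)
  rcases Int.even_or_odd' k with ⟨m, hm | hm⟩
  · -- even `k = 2m`: the 2π case
    have h2 := torusDist_sub_ge_of_expand hc hper2 hexp x y
    have hrep : torusDist (f x - f y) ≤ |f x - f y - k * π| := by
      have e : f x - f y - k * π = (f x - f y) + (-m : ℤ) * (2 * π) := by rw [hm]; push_cast; ring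
      rw [e, ← torusDist_add_int_mul_two_pi (f x - f y) (-m)]
      exact torusDist_le_abs_self _
    calc c * min (torusDist (x - y)) (torusDist (x - y - π)) ≤ c * torusDist (x - y) := mul_le_mul_of_nonneg_left (min_le_left _ _) hc
      _ ≤ _ := h2.trans hrep
  · -- odd `k = 2m + 1`: compare with `y + π`
    have h2 := torusDist_sub_ge_of_expand hc hper2 hexp x (y + π)
    have hrep : torusDist (f x - f (y + π)) ≤ |f x - f y - k * π| := by
      have e : f x - f y - k * π = (f x - f (y + π)) + (-m : ℤ) * (2 * π) := by rw [hm, hper y]; push_cast; ring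
      rw [e, ← torusDist_add_int_mul_two_pi (f x - f (y + π)) (-m)]
      exact torusDist_le_abs_self _
    have e2 : x - (y + π) = x - y - π := by ring
    rw [e2] at h2
    calc c * min (torusDist (x - y)) (torusDist (x - y - π)) ≤ c * torusDist (x - y - π) := mul_le_mul_of_nonneg_left (min_le_right _ _) hc
      _ ≤ _ := h2.trans hrep

/-! ## §2 The perturbed / frame curve -/

section Root

variable {a b : ℝ} (B : BandBounds a b) {δ : (Fin 2 → ℝ) → ℝ} (hδs : ContDiff ℝ 2 δ)
  {κ₀ κ₁ μ : ℝ} (hδ : ∀ k : Fin 2 → ℝ, (∀ i, |k i| ≤ π) → |δ k| ≤ κ₀) (hlo : a ≤ μ - κ₀) (hhi : μ + κ₀ ≤ b)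
  (hκ : ∀ k : Fin 2 → ℝ, (∀ i, |k i| ≤ π) → ‖fderiv ℝ δ k‖ ≤ κ₁) (hκ₁ : κ₁ < B.Dtmin)
  {u : ℝ → ℝ} (hu : ∀ θ, IsBandFermiRadius (μ - δ (u θ • dir θ)) θ (u θ)) (hperπ : Function.Periodic u π)
include B hδs hδ hlo hhi hκ hκ₁ hu hperπ

/-- **Mod-π injectivity modulus of the Gauss map from a tangential-Hessian floor** (H), `π`-periodic root selection:
`(u_min·w/(4+κ₁))·min(‖θ − θ′‖_𝕋, ‖θ − θ′ − π‖_𝕋) ≤ |α(θ) − α(θ′) − kπ|` for every `k : ℤ`. [cite: BenfattoGiulianiMastropietro2003, §7.1 Lemma 7.1 (A1.9)] -/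
theorem normalAngleFn_halfTorus_ge_of_hessFloor {w : ℝ} (hw : 0 ≤ w)
    (hH : ∀ θ, w * (VXE u θ ^ 2 + VYE u θ ^ 2) ≤
      2 * Real.cos (XE u θ) * VXE u θ ^ 2 + 2 * Real.cos (YE u θ) * VYE u θ ^ 2 +
        fderiv ℝ (fderiv ℝ δ) (u θ • dir θ) ![VXE u θ, VYE u θ] ![VXE u θ, VYE u θ]) (θ θ' : ℝ) (k : ℤ) :
    B.umin * w / (4 + κ₁) * min (torusDist (θ - θ')) (torusDist (θ - θ' - π)) ≤
      |(θ - Real.arctan (deriv u θ / u θ)) - (θ' - Real.arctan (deriv u θ' / u θ')) - k * π| := by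
  have hsq := abs_apply_le_pi_of_isBandFermiRadius (hu θ)
  have hκ₁0 : 0 ≤ κ₁ := le_trans (norm_nonneg _) (hκ _ hsq)
  have hc : 0 ≤ B.umin * w / (4 + κ₁) := by have := B.umin_pos; positivity
  exact abs_sub_sub_int_mul_pi_ge_of_expand (f := fun ϑ => ϑ - Real.arctan (deriv u ϑ / u ϑ)) hc
    (fun x => normalAngleFn_add_pi hperπ x)
    (fun x y hxy => normalAngleFn_sub_ge_of_hessFloor B hδs hδ hlo hhi hκ hκ₁ hu hw hH hxy) θ θ' k

end Root

section Frame

variable {a b : ℝ} (B : BandBounds a b) {K : TrigPolyC4v} {κ₀ κ₁ ν : ℝ}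
  (hδ : ∀ k : Fin 2 → ℝ, (∀ i, |k i| ≤ π) → |(fun k : Fin 2 → ℝ => -K.eval k) k| ≤ κ₀) (hlo : a ≤ ν - κ₀) (hhi : ν + κ₀ ≤ b)
  (hκ : ∀ k : Fin 2 → ℝ, (∀ i, |k i| ≤ π) → ‖fderiv ℝ (fun k : Fin 2 → ℝ => -K.eval k) k‖ ≤ κ₁) (hκ₁ : κ₁ < B.Dtmin)
  {μ Kc r₀ g₀ w : ℝ} (hG : GeomConstants (frameLevel μ K) Kc r₀ g₀ w) (hν : |ν - μ| < r₀)
include B hδ hlo hhi hκ hκ₁ hG hν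

/-- **Mod-π injectivity modulus of the frame curve's Gauss map** for a `π`-periodic root selection `u` of `{ε₀ + δ_K = ν}`, `|ν − μ| < r₀`:
`(u_min·w/(4+κ₁))·min(‖θ − θ′‖_𝕋, ‖θ − θ′ − π‖_𝕋) ≤ |α(θ) − α(θ′) − kπ|` — frame-uniform. [cite: BenfattoGiulianiMastropietro2003, §7.1 Lemma 7.1 (A1.9)] -/
theorem normalAngleFn_halfTorus_ge_of_geomConstants {u : ℝ → ℝ}
    (hu : ∀ θ, IsBandFermiRadius (ν - (fun k : Fin 2 → ℝ => -K.eval k) (u θ • dir θ)) θ (u θ)) (hperπ : Function.Periodic u π)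
    (θ θ' : ℝ) (k : ℤ) :
    B.umin * w / (4 + κ₁) * min (torusDist (θ - θ')) (torusDist (θ - θ' - π)) ≤
      |(θ - Real.arctan (deriv u θ / u θ)) - (θ' - Real.arctan (deriv u θ' / u θ')) - k * π| := by
  have hsq := abs_apply_le_pi_of_isBandFermiRadius (hu θ)
  have hκ₁0 : 0 ≤ κ₁ := le_trans (norm_nonneg _) (hκ _ hsq)
  have hc : 0 ≤ B.umin * w / (4 + κ₁) := by have := B.umin_pos; have := hG.wmin_pos; positivity
  exact abs_sub_sub_int_mul_pi_ge_of_expand (f := fun ϑ => ϑ - Real.arctan (deriv u ϑ / u ϑ)) hc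
    (fun x => normalAngleFn_add_pi hperπ x)
    (fun x y hxy => normalAngleFn_sub_ge_of_geomConstants B hδ hlo hhi hκ hκ₁ hu hG hν hxy) θ θ' k

/-- **Chart form** for the canonical root selection `u := perturbedFermiRadius δ_K ν` (`π`-periodic: `δ_K` is even by `TrigPolyC4v.eval_neg`):
`(u_min·w/(4+κ₁))·min(‖θ₂ − θ₁‖_𝕋, ‖θ₂ − θ₁ − π‖_𝕋) ≤ |α(θ₂,0) − α(θ₁,0) − kπ|`. [cite: BenfattoGiulianiMastropietro2003, §7.1 Lemma 7.1 (A1.9)] -/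
theorem normalAngle_perturbed_halfTorus_ge_of_geomConstants (θ₁ θ₂ : ℝ) (k : ℤ) :
    B.umin * w / (4 + κ₁) * min (torusDist (θ₂ - θ₁)) (torusDist (θ₂ - θ₁ - π)) ≤
      |BGM2003.normalAngle (fun ϑ e => perturbedFermiRadius (fun k : Fin 2 → ℝ => -K.eval k) (ν + e) ϑ) θ₂ 0 -
        BGM2003.normalAngle (fun ϑ e => perturbedFermiRadius (fun k : Fin 2 → ℝ => -K.eval k) (ν + e) ϑ) θ₁ 0 - k * π| := by
  rw [normalAngle_perturbed_eq, normalAngle_perturbed_eq]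
  have hδc : Continuous (fun k : Fin 2 → ℝ => -K.eval k) := (contDiff_frameShift_toLp K (m := 0)).continuous
  have hu : ∀ θ, IsBandFermiRadius (ν - (fun k : Fin 2 → ℝ => -K.eval k) (perturbedFermiRadius (fun k : Fin 2 → ℝ => -K.eval k) ν θ • dir θ)) θ
      (perturbedFermiRadius (fun k : Fin 2 → ℝ => -K.eval k) ν θ) :=
    isBandFermiRadius_perturbedFermiRadius B hδc hδ hlo hhi
  have heven : ∀ k : Fin 2 → ℝ, (fun k : Fin 2 → ℝ => -K.eval k) (-k) = (fun k : Fin 2 → ℝ => -K.eval k) k := fun k => by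
    simp only [TrigPolyC4v.eval_neg]
  exact normalAngleFn_halfTorus_ge_of_geomConstants B hδ hlo hhi hκ hκ₁ hG hν hu
    (fun θ => perturbedFermiRadius_add_pi heven ν θ) θ₂ θ₁ k

end Frame

end Summit.HubbardSuperconductivity.HubbardSuperconductivity.Theorems.PerturbedFermiCurve

end
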